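import Summits.HubbardSuperconductivity.HubbardSuperconductivity.Theorems.AnisotropyChordTransferFibre3ManifoldA64
import Summits.HubbardSuperconductivity.HubbardSuperconductivity.Theorems.AnisotropyChordTransferFibre3LamPartKT48

/-!
# Route `AnisotropyChord` / H0 rotor rung: family A on the t-BLOCK `[48,64)` — ν-ceiling, manifold band, second-shell window for `L ≥ 48`

Companion of `…ManifoldA64` for the block floor `L₀ = 48`, using the capacity constant at `L ≥ 48` (`…GreenZeroConstant48`:
`G̃₀(0) − ln L/2π ∈ [0.0442, 0.0523]`, `…GreenZeroKT48`, `…LamPartKT48`): `log_48_ge/le`, `log_div_sq_le48`,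
★ `nu_ceiling48`: `λ₂ < 0.0384·θ²` (`L ≥ 48`), ★ `manifold_band48` (band constants `0.0442 + 0.1266ν` / `0.0523 + 0.234ν`),
★ `second_shell_window48`: `|a_λ(1,1) − 1/π| ≤ 0.002`, `|a_λ(2,0) − (1 − 2/π)| ≤ 0.0048`.
Prover seat `hubbard-h0-rotor-p2` g8; helper for piece A = stmt-HubbardSuperconductivity-23918 of rung 19089 (`--supports`, helper class).
WHAT THIS IS NOT: nothing here proves superconductivity in the Hubbard model; family-A inputs of ONE conditional reduction on the t-blocks.
Tree imports only; no new definitions; no sorry.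
-/

set_option linter.dupNamespace false
set_option autoImplicit false

noncomputable section

open scoped BigOperators

namespace Summit.HubbardSuperconductivity.HubbardSuperconductivity.Theorems.AnisotropyChord.Transfer.Fibre3

namespace ManifoldA

variable (L : ℕ) [NeZero L]

/-! ## Block numerics -/

/-- `ln 48 ≥ 3.8712`. [folklore] -/
theorem log_48_ge : (3.8712 : ℝ) ≤ Real.log 48 := by
  have h : Real.log 48 = 4 * Real.log 2 + Real.log 3 := by
    rw [show (48 : ℝ) = 2 ^ 4 * 3 by norm_num, Real.log_mul (by norm_num) (by norm_num), Real.log_pow]; norm_num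
  rw [h]; linarith [Real.log_two_gt_d9, Real.log_three_gt_d9]

/-- `ln 48 ≤ 3.87121`. [folklore] -/
theorem log_48_le : Real.log 48 ≤ 3.87121 := by
  have h : Real.log 48 = 4 * Real.log 2 + Real.log 3 := by
    rw [show (48 : ℝ) = 2 ^ 4 * 3 by norm_num, Real.log_mul (by norm_num) (by norm_num), Real.log_pow]; norm_num
  rw [h]; linarith [Real.log_two_lt_d9, Real.log_three_lt_d9]

/-- `ln x/x² ≤ ln 48/48²` for `x ≥ 48` (concavity of `ln`). [folklore] -/
theorem log_div_sq_le48 (x : ℝ) (hx : 48 ≤ x) : Real.log x / x ^ 2 ≤ 3.87121 / 2304 := by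
  have hx0 : 0 < x := by linarith
  have h := Real.log_le_sub_one_of_pos (show (0 : ℝ) < x / 48 by positivity)
  rw [Real.log_div hx0.ne' (by norm_num)] at h
  have hlog : Real.log x ≤ 3.87121 + (x / 48 - 1) := by linarith [log_48_le]
  rw [div_le_iff₀ (by positivity)]
  nlinarith [mul_nonneg (sub_nonneg.mpr hx) (sub_nonneg.mpr hx)]

/-! ## The ν-ceilings of the blocks -/

/-- ★ ν-CEILING at `L ≥ 48`: `λ₂ < 0.0384·θ²` for a ground profile with `0 ≤ Δ` (`G̃₀(0) ≥ ln 48/2π + 0.0442 ≥ 0.6603`). [folklore] -/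
theorem nu_ceiling48 (hL : 48 ≤ L) {Δ lam2 : ℝ} (hΔ0 : 0 ≤ Δ) {f : Tor L → ℝ}
    (hf : IsGroundTwoMagnon L Δ lam2 f) : lam2 < 0.0384 * (2 * Real.pi / L) ^ 2 := by
  have hπlo := Real.pi_gt_d6
  have hπhi := Real.pi_lt_d6
  have hL0 : (0 : ℝ) < L := by exact_mod_cast (show 0 < L by omega)
  have hL48 : (48 : ℝ) ≤ L := by exact_mod_cast hL
  have hV : (0 : ℝ) < (L : ℝ) ^ 2 := by positivity
  have h1 := lam2_le_inv_Gres L (by omega) hΔ0 hf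
  have hG := (CapacityConst.capacity_const_bounds48 L (by omega)).1
  have hlog : Real.log 48 ≤ Real.log L := Real.log_le_log (by norm_num) hL48
  have hG2 : 0.6603 ≤ Gres L 0 0 := by
    have h2π : 0 < 2 * Real.pi := by positivity
    have : 0.6161 ≤ Real.log L / (2 * Real.pi) := by
      rw [le_div_iff₀ h2π]; nlinarith [log_48_ge]
    linarith
  have hGpos : 0 < Gres L 0 0 := by linarith
  calc lam2 ≤ 1 / ((L : ℝ) ^ 2 * Gres L 0 0) := h1
    _ ≤ 1 / ((L : ℝ) ^ 2 * 0.6603) := by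
        apply one_div_le_one_div_of_le (by positivity)
        exact mul_le_mul_of_nonneg_left hG2 hV.le
    _ < 0.0384 * (2 * Real.pi / L) ^ 2 := by
        rw [div_lt_iff₀ (by positivity)]
        have e : 0.0384 * (2 * Real.pi / L) ^ 2 * ((L : ℝ) ^ 2 * 0.6603) = 0.0384 * 0.6603 * 4 * Real.pi ^ 2 := by
          field_simp; ring
        rw [e]; nlinarith

/-! ## The manifold band for `L ≥ 48` -/


/-- ★ THE MANIFOLD BAND at `L ≥ 48`: `0 ≤ a`, `a(1 − 1/V) < 1`,
`1 − 4η gL⁺ (1 + 1/V) ≤ a`, `a(V − 1) ≤ V(1 − 4η gL⁻)` with `gL⁻ = ln L/2π + 0.0442 + 0.1266ν`,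
`gL⁺ = ln L/2π + 0.0523 + 0.234ν` (manifold equation + `capacity_KT_bounds48` + `nu_le_of_ge_31`). [folklore] -/
theorem manifold_band48 (hL : 48 ≤ L) {Δ lam2 : ℝ} (hΔ0 : 0 ≤ Δ) (hΔ1 : Δ < 1) {f : Tor L → ℝ}
    (hf : IsGroundTwoMagnon L Δ lam2 f) :
    0 ≤ Δ * f (K1 L) ∧ Δ * f (K1 L) * (1 - 1 / (L : ℝ) ^ 2) < 1 ∧
    1 - 4 * etaEff L lam2 * (Real.log L / (2 * Real.pi) + 0.0523 + 0.234 * (lam2 / (2 * Real.pi / L) ^ 2))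
        * (1 + 1 / (L : ℝ) ^ 2) ≤ Δ * f (K1 L) ∧
    Δ * f (K1 L) * ((L : ℝ) ^ 2 - 1)
      ≤ (L : ℝ) ^ 2 * (1 - 4 * etaEff L lam2 * (Real.log L / (2 * Real.pi) + 0.0442 + 0.1266 * (lam2 / (2 * Real.pi / L) ^ 2))) := by
  have hπ := Real.pi_pos
  have hL5 : 5 ≤ L := by omega
  have hL0 : (0 : ℝ) < L := by exact_mod_cast (show 0 < L by omega)
  have hL64 : (48 : ℝ) ≤ L := by exact_mod_cast hL
  have hV : (0 : ℝ) < (L : ℝ) ^ 2 := by positivity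
  have hV1 : (1 : ℝ) ≤ (L : ℝ) ^ 2 := by nlinarith
  have hVbig : (2304 : ℝ) ≤ (L : ℝ) ^ 2 := by nlinarith
  obtain ⟨_, h2, _, _, h5, _, _⟩ := manifold_dictionary L hL5 hΔ0 hΔ1 hf
  have hME := manifold_equation L hL5 hΔ0 hΔ1 hf
  have hfpos : 0 < f (K1 L) := hf.1.2.2.1
  have hpos := lam2_pos L (by omega) hΔ1 hf.1
  have hη0 : 0 < etaEff L lam2 := by unfold etaEff; positivity
  -- the capacity bracket (`ν ≤ 0.0513 ≤ 0.07` by `nu_le_of_ge_31`)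
  have hθ2 : 0 < (2 * Real.pi / L) ^ 2 := by positivity
  set ν := lam2 / (2 * Real.pi / L) ^ 2 with hν
  have hνlam : ν * (2 * Real.pi / L) ^ 2 = lam2 := by rw [hν]; field_simp
  have hν0 : 0 ≤ ν := by positivity
  have hν7 : ν ≤ 0.07 := by
    rw [hν, div_le_iff₀ hθ2]; linarith [nu_le_of_ge_31 L (by omega) hΔ0 hf]
  obtain ⟨hClo, hChi⟩ := CapacityConst.capacity_KT_bounds48 L (by omega) ν hν0 hν7
  rw [hνlam] at hClo hChi
  have hlog : 0 ≤ Real.log L / (2 * Real.pi) := by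
    have : 0 ≤ Real.log L := Real.log_nonneg (by linarith)
    positivity
  set a := Δ * f (K1 L) with ha
  set η := etaEff L lam2
  set G := Gres L lam2 0
  have hG0 : 0 < G := by linarith
  have ha0 : 0 ≤ a := mul_nonneg hΔ0 hfpos.le
  have hcS : 0 < cS L Δ lam2 f := by rw [h2]; positivity
  refine ⟨ha0, ?_, ?_, ?_⟩
  · -- `a(1 − 1/V) < 1` from `c_s G̃ = 1 − a + a/V > 0`
    have : 0 < cS L Δ lam2 f * G := mul_pos hcS hG0
    rw [h5] at this
    have e : a * (1 - 1 / (L : ℝ) ^ 2) = a - a / (L : ℝ) ^ 2 := by ring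
    rw [e]; linarith
  · -- lower band
    set gp := Real.log L / (2 * Real.pi) + 0.0523 + 0.234 * ν with hgpdef
    have hgp : G ≤ gp := by linarith
    set y := 4 * η * gp with hy
    have hgp0 : 0 ≤ gp := le_trans hG0.le hgp
    have hy0 : 0 ≤ y := by positivity
    rcases le_or_gt y 1 with hy1 | hy1
    · have h3 : (L : ℝ) ^ 2 * (1 - a) + a ≤ y * ((L : ℝ) ^ 2 + a) := by
        rw [← hME, hy]
        exact mul_le_mul_of_nonneg_right (mul_le_mul_of_nonneg_left hgp (by positivity)) (by positivity)
      have h4 : (L : ℝ) ^ 2 * (1 - y) ≤ a * ((L : ℝ) ^ 2 - 1 + y) := by linarith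
      have key := lower_band_ineq y ((L : ℝ) ^ 2) hy0 hy1 hV1
      have hD : 0 < (L : ℝ) ^ 2 - 1 + y := by linarith
      exact le_of_mul_le_mul_right (key.trans h4) hD
    · have : 0 ≤ y * (1 / (L : ℝ) ^ 2) := by positivity
      have : 1 - y * (1 + 1 / (L : ℝ) ^ 2) < 0 := by nlinarith
      linarith
  · -- upper band: `4η gm V ≤ 4η G (V + a) = V(1−a) + a`
    set gm := Real.log L / (2 * Real.pi) + 0.0442 + 0.1266 * ν with hgmdef
    have hgm : gm ≤ G := by linarith
    have e1 : 4 * η * gm * (L : ℝ) ^ 2 ≤ 4 * η * G * (L : ℝ) ^ 2 :=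
      mul_le_mul_of_nonneg_right (mul_le_mul_of_nonneg_left hgm (by positivity)) hV.le
    have e2 : 4 * η * G * (L : ℝ) ^ 2 ≤ 4 * η * G * ((L : ℝ) ^ 2 + a) :=
      mul_le_mul_of_nonneg_left (by linarith) (by positivity)
    have h3 : 4 * η * gm * (L : ℝ) ^ 2 ≤ (L : ℝ) ^ 2 * (1 - a) + a := by rw [← hME]; linarith
    linarith

/-! ## The second-shell window for `L ≥ 48` -/

/-- ★ SECOND-SHELL WINDOW at `L ≥ 48` (`0 ≤ ν ≤ 0.0513`, `λ = ν(2π/L)²`): `|a_λ(1,1) − 1/π| ≤ 0.002` and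
`|a_λ(2,0) − (1 − 2/π)| ≤ 0.0048` (λ-parts `≤ 2ν·0.0145`, `≤ 4ν·0.0145`; `λ = 0` deviations `≤ 1/2304`, `4/2304`). [folklore] -/
theorem second_shell_window48 (hL : 48 ≤ L) (ν : ℝ) (hν0 : 0 ≤ ν) (hν : ν ≤ 0.0513) :
    |aKer L (ν * (2 * Real.pi / L) ^ 2) ((((1 : ℤ)) : ZMod L), (((1 : ℤ)) : ZMod L)) - 1 / Real.pi| ≤ 0.002 ∧
    |aKer L (ν * (2 * Real.pi / L) ^ 2) ((((2 : ℤ)) : ZMod L), (((0 : ℤ)) : ZMod L)) - (1 - 2 / Real.pi)| ≤ 0.0048 := by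
  have hL0 : (0 : ℝ) < L := by exact_mod_cast (show 0 < L by omega)
  have hL64 : (48 : ℝ) ≤ L := by exact_mod_cast hL
  have hV : (0 : ℝ) < (L : ℝ) ^ 2 := by positivity
  have hν7 : ν ≤ 0.07 := by linarith
  have hlogq := log_div_sq_le48 (L : ℝ) hL64
  have hinv : 1 / (L : ℝ) ^ 2 ≤ 1 / 2304 := one_div_le_one_div_of_le (by norm_num) (by nlinarith)
  have hlog0 : 0 ≤ Real.log L := Real.log_nonneg (by linarith)
  -- λ-parts
  have hl11 := CapacityConst.lamPart_KT_le48 L (by omega) ν hν0 hν7 1 1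
  have hl20 := CapacityConst.lamPart_KT_le48 L (by omega) ν hν0 hν7 2 0
  have hε : 0 < eps1 L := RateLemma.eps1_pos_of_two_le L (by omega)
  have hπlo := Real.pi_gt_d6
  have hπhi := Real.pi_lt_d6
  have hlam0 : 0 ≤ ν * (2 * Real.pi / L) ^ 2 := by positivity
  have hlam1 : ν * (2 * Real.pi / L) ^ 2 < 2 * eps1 L := by
    have hεJ : 2 / Real.pi ^ 2 * (2 * Real.pi / L) ^ 2 ≤ eps1 L := RateLemma.eps1_ge_jordan L (by omega)
    have h1 : ν * (2 * Real.pi / L) ^ 2 < 4 / Real.pi ^ 2 * (2 * Real.pi / L) ^ 2 := by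
      apply mul_lt_mul_of_pos_right _ (by positivity)
      rw [lt_div_iff₀ (by positivity)]; nlinarith
    have h2 : 4 / Real.pi ^ 2 * (2 * Real.pi / L) ^ 2 = 2 * (2 / Real.pi ^ 2 * (2 * Real.pi / L) ^ 2) := by ring
    linarith
  have hp11 := (RateLemma.lamPartShellBound_holds L (by omega) _ hlam0 hlam1 ((((1 : ℤ)) : ZMod L), (((1 : ℤ)) : ZMod L))).1
  have hp20 := (RateLemma.lamPartShellBound_holds L (by omega) _ hlam0 hlam1 ((((2 : ℤ)) : ZMod L), (((0 : ℤ)) : ZMod L))).1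
  -- λ = 0 deviations
  have hd11 := Subsample.dev_one_one L (by omega)
  have hd20 := Subsample.dev_two_zero L (by omega)
  rw [Subsample.aZ2_one_one] at hd11
  rw [Subsample.aZ2_two_zero'] at hd20
  obtain ⟨hd11a, hd11b⟩ := abs_le.mp hd11
  obtain ⟨hd20a, hd20b⟩ := abs_le.mp hd20
  -- numeric sizes: `(7.76 ln L + 3.35)/L² ≤ 0.0145`
  have hsz : (7.76 * Real.log L + 3.35) / (L : ℝ) ^ 2 ≤ 0.0145 := by
    have e : (7.76 * Real.log L + 3.35) / (L : ℝ) ^ 2 = 7.76 * (Real.log L / (L : ℝ) ^ 2) + 3.35 * (1 / (L : ℝ) ^ 2) := by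
      field_simp
    rw [e]; nlinarith
  have hl11' : RateLemma.lamPart L (ν * (2 * Real.pi / L) ^ 2) ((((1 : ℤ)) : ZMod L), (((1 : ℤ)) : ZMod L)) ≤ 0.0015 := by
    refine hl11.trans ?_
    push_cast
    have e : ν * ((1 : ℝ) ^ 2 + (1 : ℝ) ^ 2) * (7.76 * Real.log L + 3.35) / (L : ℝ) ^ 2
        = 2 * ν * ((7.76 * Real.log L + 3.35) / (L : ℝ) ^ 2) := by ring
    rw [e]
    have h0 : 0 ≤ (7.76 * Real.log L + 3.35) / (L : ℝ) ^ 2 := by positivity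
    have := mul_le_mul hν hsz h0 (by norm_num)
    linarith
  have hl20' : RateLemma.lamPart L (ν * (2 * Real.pi / L) ^ 2) ((((2 : ℤ)) : ZMod L), (((0 : ℤ)) : ZMod L)) ≤ 0.003 := by
    refine hl20.trans ?_
    push_cast
    have e : ν * ((2 : ℝ) ^ 2 + (0 : ℝ) ^ 2) * (7.76 * Real.log L + 3.35) / (L : ℝ) ^ 2
        = 4 * ν * ((7.76 * Real.log L + 3.35) / (L : ℝ) ^ 2) := by ring
    rw [e]
    have h0 : 0 ≤ (7.76 * Real.log L + 3.35) / (L : ℝ) ^ 2 := by positivity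
    have := mul_le_mul hν hsz h0 (by norm_num)
    linarith
  have e11 : aKer L (ν * (2 * Real.pi / L) ^ 2) ((((1 : ℤ)) : ZMod L), (((1 : ℤ)) : ZMod L))
      = aKer L 0 ((((1 : ℤ)) : ZMod L), (((1 : ℤ)) : ZMod L))
        + RateLemma.lamPart L (ν * (2 * Real.pi / L) ^ 2) ((((1 : ℤ)) : ZMod L), (((1 : ℤ)) : ZMod L)) := by
    unfold RateLemma.lamPart; ring
  have e20 : aKer L (ν * (2 * Real.pi / L) ^ 2) ((((2 : ℤ)) : ZMod L), (((0 : ℤ)) : ZMod L))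
      = aKer L 0 ((((2 : ℤ)) : ZMod L), (((0 : ℤ)) : ZMod L))
        + RateLemma.lamPart L (ν * (2 * Real.pi / L) ^ 2) ((((2 : ℤ)) : ZMod L), (((0 : ℤ)) : ZMod L)) := by
    unfold RateLemma.lamPart; ring
  have h4 : 4 / (L : ℝ) ^ 2 ≤ 4 / 2304 := by
    apply div_le_div_of_nonneg_left (by norm_num) (by norm_num) (by nlinarith)
  constructor
  · rw [e11, abs_le]; constructor <;> linarith only [hd11a, hd11b, hp11, hl11', hinv]
  · rw [e20, abs_le]; constructor <;> linarith only [hd20a, hd20b, hp20, hl20', h4]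

end ManifoldA

end Summit.HubbardSuperconductivity.HubbardSuperconductivity.Theorems.AnisotropyChord.Transfer.Fibre3

end
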